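import Summits.HodgeConjecture.HodgeConjecture.Theorems.PadicSemiregularLiftHodgeFermatVarietiesFiveQPrelim
import Summits.HodgeConjecture.HodgeConjecture.Theorems.PadicSemiregularLiftHodgeFermatVarietiesPairedOfLargePrimesLevel
import Literature.AlgebraicGeometry.HodgeTheory.FermatHodgeCharacterCriterion
import Literature.AlgebraicGeometry.HodgeTheory.FermatHodgeCharacterLocal
import Literature.AlgebraicGeometry.HodgeTheory.FermatHodgeCharacterExistence
import HarnessLib

/-!
# The twin core `35 ∣ m`: the unit parts of a Hodge character all of whose entries have exact level `35` are even — line `cancel-by-any-claim-lattice`, crux `HodgeFermatVarieties` (stmt-HodgeConjecture-1334)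

Programme T6 of lead c4 (removing the "sextuple twin core" `35 ∣ m`), stub T6-K `stub_twin_thirtyFive_even`.
Setting: a level `m` with `35 ∣ m` and a Hodge character `α : Fin R → ℤ/m` ALL of whose coordinates have
exact level `m / gcd(m, ⟨αᵢ⟩) = 35`; write `αᵢ = (m/35)·wᵢ` with `wᵢ` a unit mod `35` (`unitPart_spec`).
THEOREM: the multiplicity function `u ↦ #{i : wᵢ = u}` on `ℤ/35` is EVEN.

Proof. Aoki's criterion (`IsHodge.aoki_criterion`) at a conductor `f ∈ {5, 7, 35}` (all dividing `m`) for
an odd primitive `χ` mod `f` reads, since every level is `35`,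
`c · ∑ᵢ χ(wᵢ mod f)⁻¹ = 0` with the constant `c = (φ(m)/φ(35)) · (1 - χ(5)) (1 - χ(7))`;
`c ≠ 0`: for `f = 5` it is `(φ m/φ 35)(1 - χ(2))` and an odd character mod `5` has `χ(2) ≠ 1`
(`FiveQ.char_five_two_ne_one`); for `f = 7` it is `(φ m/φ 35)(1 - χ(5))` and a non-trivial character
mod `7` has `χ(5) ≠ 1` (`FiveQ.char_seven_five_ne_one`); for `f = 35` both Euler factors are `1`. Hence
`∑ᵢ χ(wᵢ mod f) = 0` (complex conjugation). Every odd character `ψ` mod `35` is `χ₁ ⊠ χ₂` with `χ₁` mod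
`5`, `χ₂` mod `7` (`exists_eq_prodChar`), of opposite parities (`parities_of_prodChar_odd`): if both are
non-trivial `ψ` is primitive (`prodChar_isPrimitive`, conductor `35`); if `χ₂ = 1` then `ψ(wᵢ) = χ₁(wᵢ mod 5)`
with `χ₁` odd (conductor `5`); if `χ₁ = 1`, conductor `7`. So `∑ᵢ ψ(wᵢ) = 0` for every odd `ψ` mod `35`,
i.e. the multiplicity function is orthogonal to the odd characters, hence even on units
(`FiveQ.even_of_orthogonal_odd`); off the units it vanishes identically. Everything here is proved; no
named facts.

References: [Aoki1983] N. Aoki, Math. Ann. 266 (1983) 23–54, Prop. 2.1–2.2, Lemma 4.4, Thm. A′ (§7).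
-/

-- every sibling file of the line declares into `…CancelByAnyClaimLattice.PairedNull` from a differently named module
set_option linter.dupNamespace false

noncomputable section

open Finset
open Literature.AlgebraicGeometry.HodgeTheory Literature.AlgebraicGeometry.HodgeTheory.FermatCharacter

namespace Summit.HodgeConjecture.HodgeConjecture.Theorems.CancelByAnyClaimLattice

namespace PairedNull

section TwinThirtyFive

variable {m : ℕ} [NeZero m] {R : ℕ} {α : Fin R → ZMod m}

/-- `unitPart_spec` transported to a named exact level: if `m / gcd(m, ⟨x⟩) = M` then the unit part
`⟨x⟩ / (m/M)` read mod `M` is a unit and `x = (m/M) · ⟨unit part⟩`. [cite: Aoki1983, Prop. 2.1] -/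
theorem unitPart_spec_of_level_eq (x : ZMod m) {M : ℕ} (hM : m / m.gcd x.val = M) :
    IsUnit (((x.val / (m / M) : ℕ) : ZMod M)) ∧
      ((m / M : ℕ) : ZMod m) * ((ZMod.val (((x.val / (m / M) : ℕ) : ZMod M)) : ℕ) : ZMod m) = x := by
  subst hM
  exact unitPart_spec x

/-- The prime factors of `35` are `5` and `7`. [folklore] -/
private theorem primeFactors_thirtyFive : (35 : ℕ).primeFactors = {5, 7} := by
  rw [show (35 : ℕ) = 5 * 7 from rfl, Nat.primeFactors_mul (by norm_num) (by norm_num),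
    Nat.prime_five.primeFactors, (by decide : (7 : ℕ).Prime).primeFactors, Finset.insert_eq]

/-- A Dirichlet character vanishes at a prime dividing its level. [folklore] -/
private theorem char_natCast_eq_zero_of_prime_dvd {f : ℕ} [NeZero f] (χ : DirichletCharacter ℂ f) {p : ℕ}
    (hp : p.Prime) (hpf : p ∣ f) : χ (p : ZMod f) = 0 :=
  χ.map_nonunit (by
    rw [ZMod.isUnit_iff_coprime]
    exact fun hc ↦ hp.one_lt.ne' (Nat.Coprime.eq_one_of_dvd hc hpf))

/-- The trivial Dirichlet character is not odd (`1(-1) = 1 ≠ -1` in `ℂ`). [folklore] -/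
private theorem not_odd_one {n : ℕ} : ¬ (1 : DirichletCharacter ℂ n).Odd :=
  DirichletCharacter.Even.not_odd _ (MulChar.one_apply isUnit_one.neg)

/-- An odd Dirichlet character is non-trivial. [folklore] -/
private theorem ne_one_of_odd_char {n : ℕ} {χ : DirichletCharacter ℂ n} (hχ : χ.Odd) : χ ≠ 1 :=
  fun h1 ↦ not_odd_one (h1 ▸ hχ)

/-- **Aoki's criterion at a conductor `f ∣ 35` when every entry has exact level `35`.** For a Hodge
character `α` with `αᵢ = (m/35)·wᵢ`, `wᵢ` units mod `35`, and an odd primitive `χ` mod `f ∣ 35` whose Euler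
factor `∏_{p ∣ 35} (1 - χ(p))` is non-zero: `∑ᵢ χ(wᵢ mod f) = 0`. (The criterion reads
`(φ m/φ 35) ∏_{p ∣ 35}(1 - χ p) · ∑ᵢ χ(wᵢ mod f)⁻¹ = 0`; cancel the constant and conjugate.)
[cite: Aoki1983, Prop. 2.2] -/
theorem sum_char_cast_eq_zero_of_level_thirtyFive (h : IsHodge α) (h35 : 35 ∣ m) {w : Fin R → ZMod 35}
    (hw : ∀ i, IsUnit (w i)) (hα : ∀ i, α i = ((m / 35 : ℕ) : ZMod m) * ((ZMod.val (w i) : ℕ) : ZMod m))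
    {f : ℕ} [NeZero f] (hf : f ∣ 35) {χ : DirichletCharacter ℂ f} (hχ : χ.Odd) (hprim : χ.IsPrimitive)
    (hE : ∏ p ∈ (35 : ℕ).primeFactors, (1 - χ p) ≠ 0) :
    ∑ i, χ (ZMod.cast (w i) : ZMod f) = 0 := by
  have key := h.aoki_criterion (hf.trans h35) hχ hprim (fun _ ↦ 35) (fun _ ↦ h35) w hw hα
  have key' : ∑ i, ((m.totient : ℂ) / ((35 : ℕ).totient : ℂ)) * (∏ p ∈ (35 : ℕ).primeFactors, (1 - χ p)) *
      (χ (ZMod.cast (w i) : ZMod f))⁻¹ = 0 :=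
    (Finset.sum_congr rfl fun i _ ↦ (if_pos hf).symm).trans key
  rw [← Finset.mul_sum] at key'
  have hA : ((m.totient : ℂ) / ((35 : ℕ).totient : ℂ)) * (∏ p ∈ (35 : ℕ).primeFactors, (1 - χ p)) ≠ 0 :=
    mul_ne_zero (div_ne_zero (by exact_mod_cast (Nat.totient_pos.mpr (NeZero.pos m)).ne')
      (by exact_mod_cast (Nat.totient_pos.mpr (by norm_num : 0 < 35)).ne')) hE
  have hsum := (mul_eq_zero.mp key').resolve_left hA
  have hconj : starRingEnd ℂ (∑ i, χ (ZMod.cast (w i) : ZMod f)) = 0 := by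
    rw [map_sum, ← hsum]
    exact Finset.sum_congr rfl fun i _ ↦ (char_inv_eq_conj χ _).symm
  have := congrArg (starRingEnd ℂ) hconj
  rwa [starRingEnd_self_apply, map_zero] at this

/-- **Orthogonality to every odd character mod `35`.** Under the hypotheses of
`sum_char_cast_eq_zero_of_level_thirtyFive`: `∑ᵢ ψ(wᵢ) = 0` for every ODD `ψ` mod `35` (write
`ψ = χ₁ ⊠ χ₂`, `χ₁` mod `5`, `χ₂` mod `7`, of opposite parities; conductor `35` if both are non-trivial,
conductor `5` if `χ₂ = 1`, conductor `7` if `χ₁ = 1`). [cite: Aoki1983, Prop. 2.2, Thm. A′ (§7)] -/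
theorem sum_odd_char_eq_zero_of_level_thirtyFive (h : IsHodge α) (h35 : 35 ∣ m) {w : Fin R → ZMod 35}
    (hw : ∀ i, IsUnit (w i)) (hα : ∀ i, α i = ((m / 35 : ℕ) : ZMod m) * ((ZMod.val (w i) : ℕ) : ZMod m))
    (ψ : DirichletCharacter ℂ 35) (hψ : ψ.Odd) : ∑ i, ψ (w i) = 0 := by
  have h57 : (5 : ℕ).Coprime 7 := by norm_num
  have h7 : (7 : ℕ).Prime := by decide
  obtain ⟨χ₁, χ₂, hψeq, -⟩ := exists_eq_prodChar h57 ψ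
  subst hψeq
  have hpar := parities_of_prodChar_odd hψ
  by_cases h₁ : χ₁ = 1 <;> by_cases h₂ : χ₂ = 1
  · -- both trivial: `ψ` would be even
    exfalso
    rcases hpar with ⟨ho, -⟩ | ⟨-, ho⟩
    · exact not_odd_one (h₁ ▸ ho)
    · exact not_odd_one (h₂ ▸ ho)
  · -- `χ₁ = 1`, `χ₂` odd non-trivial: conductor `7`
    subst h₁
    have ho : χ₂.Odd := by
      rcases hpar with ⟨ho, -⟩ | ⟨-, ho⟩
      · exact absurd ho not_odd_one
      · exact ho
    have hE : ∏ p ∈ (35 : ℕ).primeFactors, (1 - χ₂ p) ≠ 0 := by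
      rw [primeFactors_thirtyFive, Finset.prod_pair (by norm_num),
        char_natCast_eq_zero_of_prime_dvd χ₂ (p := 7) h7 dvd_rfl, sub_zero, mul_one, Nat.cast_ofNat]
      exact sub_ne_zero.mpr (FiveQ.char_seven_five_ne_one χ₂ (ne_one_of_odd_char ho)).symm
    have key := sum_char_cast_eq_zero_of_level_thirtyFive h h35 hw hα (f := 7) ⟨5, rfl⟩ ho
      (isPrimitive_of_ne_one_prime h7 h₂) hE
    rw [← key]
    refine Finset.sum_congr rfl fun i _ ↦ ?_
    rw [prodChar_apply, MulChar.one_apply ((hw i).map _), one_mul, ZMod.castHom_apply]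
  · -- `χ₂ = 1`, `χ₁` odd non-trivial: conductor `5`
    subst h₂
    have ho : χ₁.Odd := by
      rcases hpar with ⟨ho, -⟩ | ⟨-, ho⟩
      · exact ho
      · exact absurd ho not_odd_one
    have hE : ∏ p ∈ (35 : ℕ).primeFactors, (1 - χ₁ p) ≠ 0 := by
      rw [primeFactors_thirtyFive, Finset.prod_pair (by norm_num),
        char_natCast_eq_zero_of_prime_dvd χ₁ (p := 5) Nat.prime_five dvd_rfl, sub_zero, one_mul,
        show ((7 : ℕ) : ZMod 5) = 2 by decide]
      exact sub_ne_zero.mpr (FiveQ.char_five_two_ne_one χ₁ ho).symm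
    have key := sum_char_cast_eq_zero_of_level_thirtyFive h h35 hw hα (f := 5) ⟨7, rfl⟩ ho
      (isPrimitive_of_ne_one_prime Nat.prime_five h₁) hE
    rw [← key]
    refine Finset.sum_congr rfl fun i _ ↦ ?_
    rw [prodChar_apply, MulChar.one_apply ((hw i).map _), mul_one, ZMod.castHom_apply]
  · -- both non-trivial: `ψ` is primitive, conductor `35`
    have hprim := prodChar_isPrimitive h57 (isPrimitive_of_ne_one_prime Nat.prime_five h₁)
      (isPrimitive_of_ne_one_prime h7 h₂)
    have hE : ∏ p ∈ (35 : ℕ).primeFactors,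
        (1 - (DirichletCharacter.changeLevel (dvd_mul_right 5 7) χ₁ *
          DirichletCharacter.changeLevel (dvd_mul_left 7 5) χ₂) p) ≠ 0 := by
      rw [Finset.prod_eq_one fun p hp ↦ by
        rw [char_natCast_eq_zero_of_prime_dvd _ (Nat.prime_of_mem_primeFactors hp)
          (Nat.dvd_of_mem_primeFactors hp), sub_zero]]
      exact one_ne_zero
    have key := sum_char_cast_eq_zero_of_level_thirtyFive h h35 hw hα (f := 35) dvd_rfl hψ hprim hE
    rw [← key]
    exact Finset.sum_congr rfl fun i _ ↦ by rw [ZMod.cast_id]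

/-- **Evenness from orthogonality to the odd characters mod `35`.** If `w : Fin R → ℤ/35` takes unit
values and `∑ᵢ ψ(wᵢ) = 0` for every odd `ψ` mod `35`, then the multiplicity function of `w` is even
(on units by `FiveQ.even_of_orthogonal_odd`; off the units both counts vanish). [cite: Aoki1983, Lemma 4.4] -/
theorem card_filter_neg_eq_of_sum_odd_char_eq_zero {w : Fin R → ZMod 35} (hw : ∀ i, IsUnit (w i))
    (horth : ∀ ψ : DirichletCharacter ℂ 35, ψ.Odd → ∑ i, ψ (w i) = 0) (u : ZMod 35) :
    #(univ.filter fun i ↦ w i = -u) = #(univ.filter fun i ↦ w i = u) := by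
  classical
  by_cases hu : IsUnit u
  · have hTorth : ∀ χ : DirichletCharacter ℂ 35, χ (-1) = -1 →
        ∑ x : ZMod 35, (#(univ.filter fun i ↦ w i = x) : ℂ) * χ x = 0 :=
      fun χ hχ ↦ (sum_comp_eq_sum_card_mul univ w χ).symm.trans (horth χ hχ)
    have hev := FiveQ.even_of_orthogonal_odd (fun x ↦ (#(univ.filter fun i ↦ w i = x) : ℂ)) hTorth hu.unit
    simp only [IsUnit.unit_spec, Nat.cast_inj] at hev
    exact hev.symm
  · have h0 : ∀ v : ZMod 35, ¬ IsUnit v → #(univ.filter fun i ↦ w i = v) = 0 := by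
      intro v hv
      rw [Finset.card_eq_zero, Finset.filter_eq_empty_iff]
      exact fun i _ hi ↦ hv (hi ▸ hw i)
    rw [h0 u hu, h0 (-u) fun hn ↦ hu ((IsUnit.neg_iff u).mp hn)]

/-- **T6-K, section-variable form.** For a Hodge character `α : Fin R → ℤ/m`, `35 ∣ m`, all of whose
coordinates have exact level `35`, the multiplicity function of the unit parts `⟨αᵢ⟩/(m/35)` on `ℤ/35` is
even. [cite: Aoki1983, Prop. 2.2, Lemma 4.4, Thm. A′ (§7)] -/
theorem twin_thirtyFive_even (h : IsHodge α) (h35 : 35 ∣ m) (hlev : ∀ i, m / m.gcd (α i).val = 35)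
    (u : ZMod 35) :
    #(univ.filter fun i : Fin R ↦ ((((α i).val / (m / 35)) : ℕ) : ZMod 35) = -u) =
      #(univ.filter fun i : Fin R ↦ ((((α i).val / (m / 35)) : ℕ) : ZMod 35) = u) :=
  card_filter_neg_eq_of_sum_odd_char_eq_zero (w := fun i ↦ ((((α i).val / (m / 35)) : ℕ) : ZMod 35))
    (fun i ↦ (unitPart_spec_of_level_eq (α i) (hlev i)).1)
    (fun ψ hψ ↦ sum_odd_char_eq_zero_of_level_thirtyFive h h35
      (fun i ↦ (unitPart_spec_of_level_eq (α i) (hlev i)).1)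
      (fun i ↦ (unitPart_spec_of_level_eq (α i) (hlev i)).2.symm) ψ hψ) u

end TwinThirtyFive

/-- **T6-K `stub_twin_thirtyFive_even`** (registered form of `twin_thirtyFive_even`): when every coordinate of a
Hodge character has exact level `35`, the multiplicity function of the unit parts on `ℤ/35` is even.
[cite: Aoki1983, Prop. 2.2, Lemma 4.4, Thm. A′ (§7)] -/
theorem stub_twin_thirtyFive_even : ∀ {m : ℕ} [NeZero m] {R : ℕ} {α : Fin R → ZMod m}, FermatCharacter.IsHodge α → (35 : ℕ) ∣ m → (∀ i : Fin R, m / m.gcd (α i).val = 35) → ∀ u : ZMod 35, #(univ.filter fun i : Fin R ↦ ((((α i).val / (m / 35)) : ℕ) : ZMod 35) = -u) = #(univ.filter fun i : Fin R ↦ ((((α i).val / (m / 35)) : ℕ) : ZMod 35) = u) :=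
  fun h h35 hlev u ↦ twin_thirtyFive_even h h35 hlev u

end PairedNull

end Summit.HodgeConjecture.HodgeConjecture.Theorems.CancelByAnyClaimLattice

end
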